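import Summits.NavierStokesRegularity.NavierStokesRegularity.Theorems.TypeICertificateLadderTargetRotationDefectWeight
import Summits.NavierStokesRegularity.NavierStokesRegularity.Theorems.TypeICertificateLadderTargetTwistedHeadIdentity
import Literature.Analysis.FluidPDE.PineauVicolWeightBounds
import HarnessLib

/-!
# Crux `Target` (stmt-NavierStokesRegularity-1217), line `killing-twisted-bernoulli-solitons`:
  the ROTATION-DEFECT bound for rotated self-similar profiles (tool file 3 of 3 for stub B5b)

Support file (helpers only, `--supports stmt-NavierStokesRegularity-1217`) for the window stub
B5b (`stub_windowLiouville`) of the line: a Type-I rotated self-similar (RSS) profile in the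
open window of rotation rates must be QUANTITATIVELY far from the axisymmetric kernel of the
rotation operator `R U = JU − (Jy·∇)U` (Pineau–Vicol, arXiv:2607.09619, §1.2 p. 5 and §6).
Main result:

* `rotationDefect_setIntegral_ball_norm_curl_sq_le` — **the rotation-defect bound**: for every
  Type-I constant `C₀ > 0` and radius `R` there is `K = K(C₀, R)` such that every smooth
  divergence-free solution `(U, P)` of the RSS profile system (1.8a) with `|U(y)| ≤ C₀/(1+|y|)`
  and bounded `DU`, `ΔU` satisfies
  `∫_{B_R} |curl U|² ≤ K · |α| · ∫ ‖U + ½y‖ ‖RU‖ e^{−|y|²/16} dy`.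

Proof: Pineau–Vicol's weighted enstrophy identity (5.4), `∫ |Ω|² w = α ∫ E w` (tree:
`PineauVicol2026.integral_weight_mul_norm_curl_sq`, with the pressure Poisson equation supplied
by `twistedHead_sum_pderiv_pderiv_pressure` of stub B1's file), for the `α = 0` conjugate
weight `w = γ v` of Proposition 5.1′ (tree: `PineauVicol2026.DriftHyp.exists_weight`, `ε = ¾`:
`m e^{−7|y|²/16} ≤ w ≤ M e^{−|y|²/16}`, `m, M` depending on `C₀` only). Its five integrability
hypotheses are discharged from the polynomial bounds of the companion files
`TypeICertificateLadderTargetRotationDefectBounds` / `…Weight` and — for `|Π||∇w|`, the "mild decay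
information on `∇w`" of footnote 16 — from the `L²(γ)` data `v, ∇v ∈ L²(γ)` of the weight
(`rotationDefect_integrable_head_mul_gradient_weight`, AM–GM). Then
`|α ∫ E w| ≤ |α| M ∫ ‖U + ½y‖‖RU‖ e^{−|y|²/16}` by the pointwise form `E = −⟪U + ½y, RU⟫` of the
error term (`rotationDefect_weighted_enstrophy_le`), and
`m e^{−7R²/16} ∫_{B_R} |Ω|² ≤ ∫ |Ω|² w` (`rotationDefect_mul_setIntegral_ball_le`).

With the gap lemma (Prop. 3.1; stub B4 of the line) and the conjugate density (stub B2) this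
yields the all-`α` stratum "`|α| ∫ ‖U + ½y‖‖RU‖ e^{−|y|²/16} ≤ δ(C₀) ⇒ U ≡ 0`" (next file),
which contains the small-`|α|` half of Theorem 1.4 by the paper's own quantitative method (§5;
the tree's discharge `pineauVicol2026_rss_liouville_holds` went through Chae–Wolf compactness)
and is the quantitative-axisymmetry input named by the B5b squeeze; it does NOT close B5b.

## References

* B. Pineau, V. Vicol, arXiv:2607.09619 (2026): (1.8a) p. 3; §4 (4.3)–(4.4) p. 11; Prop. 5.1,
  (5.3)–(5.4), footnote 16 and the proof of Thm. 1.4 for small `|α|`, pp. 12–13; §1.2 p. 5 and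
  Prop. 6.5 (the role of `RU`). [PineauVicol2026]
-/

noncomputable section

namespace Summit.NavierStokesRegularity.NavierStokesRegularity.Theorems

open MeasureTheory Set Function Filter Topology InnerProductSpace Real Metric
open scoped RealInnerProductSpace Laplacian ContDiff BigOperators ENNReal NNReal
open Literature.Analysis.FluidPDE Literature.Analysis.FluidPDE.PineauVicol2026

/-! ### The rotation-defect bound -/

/-- **The rotation-defect bound (profile level).** For every `C₀ > 0` and radius `R` there is
`K > 0` (depending on `C₀` and `R` only: `K = M_{¾}(C₀) / (m_{¾}(C₀) e^{−7R²/16})` with the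
constants of the tree's Prop. 5.1′) such that: if `U, P` are smooth on `ℝ³`, `∇·U = 0`, and
solve the rotated self-similar profile system (Pineau–Vicol (1.8a))
`α(JU − DU(Jy)) + ½U + ½DU(y) − ΔU + DU(U) + ∇P = 0` with the Type-I profile bound
`|U(y)| ≤ C₀/(1+|y|)` ((1.9)) and bounded `DU`, `ΔU` (on Pineau–Vicol's class these hold by
Lemma 2.1), then
`∫_{B_R} |curl U|² dy ≤ K · |α| · ∫ ‖U(y) + ½y‖ ‖JU(y) − DU(y)(Jy)‖ e^{−|y|²/16} dy`.
This is the weighted identity (5.4) `∫|Ω|²w = α∫Ew` for the `α = 0` conjugate weight of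
Prop. 5.1 (`ε = ¾`), with `|E| ≤ ‖U + ½y‖‖RU‖` pointwise and the two-sided Gaussian bounds
(5.3); it is the quantitative content of "a smooth solution `U` wants to stay close to the
kernel of the operator `R = J − (Jy)·∇`" (p. 5) as an all-`α` inequality.
[cite: PineauVicol2026, (5.4) and proof of Thm. 1.4 small |α| (p. 13); Prop. 5.1 (p. 12); §1.2 (p. 5)] -/
theorem rotationDefect_setIntegral_ball_norm_curl_sq_le {C₀ : ℝ} (hC₀ : 0 < C₀) (R : ℝ) :
    ∃ K : ℝ, 0 < K ∧
    ∀ (α : ℝ) (U : EuclideanSpace ℝ (Fin 3) → EuclideanSpace ℝ (Fin 3))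
      (P : EuclideanSpace ℝ (Fin 3) → ℝ),
      ContDiff ℝ ∞ U → ContDiff ℝ ∞ P → VectorCalculus.IsDivFree U →
      (∀ y, α • (rotGen (U y) - fderiv ℝ U y (rotGen y)) + (1 / 2 : ℝ) • U y +
        (1 / 2 : ℝ) • fderiv ℝ U y y - (Δ U) y + fderiv ℝ U y (U y) + gradient P y = 0) →
      (∀ y, ‖U y‖ ≤ C₀ / (1 + ‖y‖)) →
      (∃ C₁ : ℝ, ∀ y, ‖fderiv ℝ U y‖ ≤ C₁) → (∃ C₂ : ℝ, ∀ y, ‖(Δ U) y‖ ≤ C₂) →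
      ∫ y in ball (0 : EuclideanSpace ℝ (Fin 3)) R, ‖curl U y‖ ^ 2 ≤
        K * (|α| * ∫ y, ‖U y + (1 / 2 : ℝ) • y‖ * ‖rotGen (U y) - fderiv ℝ U y (rotGen y)‖ *
          Real.exp (-‖y‖ ^ 2 / 16)) := by
  -- the constants of Prop. 5.1′ at `ε = ¾`
  set M : ℝ := weightUpperConst (EuclideanSpace ℝ (Fin 3)) C₀ (3 / 4) with hM
  set m : ℝ := weightLowerConst (EuclideanSpace ℝ (Fin 3)) C₀ (3 / 4) with hm
  have hMpos : 0 < M := weightUpperConst_pos _ _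
  have hmpos : 0 < m := weightLowerConst_pos _ _
  set L : ℝ := m * Real.exp (-(7 / 16 : ℝ) * R ^ 2) with hL
  have hLpos : 0 < L := mul_pos hmpos (Real.exp_pos _)
  refine ⟨M / L, div_pos hMpos hLpos, ?_⟩
  intro α U P hU hP hdiv heq hU0 hU1 hU2
  obtain ⟨C₁, hC₁⟩ := hU1
  obtain ⟨C₂, hC₂⟩ := hU2
  have hC₁0 : 0 ≤ C₁ := (norm_nonneg _).trans (hC₁ 0)
  -- the drift hypotheses of Prop. 5.1′ with constant `C₀`
  have hy1 : ∀ y : EuclideanSpace ℝ (Fin 3), (1 : ℝ) ≤ 1 + ‖y‖ := fun y => by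
    linarith [norm_nonneg y]
  have hUb : ∀ y, ‖U y‖ ≤ C₀ := fun y => (hU0 y).trans (div_le_self hC₀.le (hy1 y))
  have hDH : DriftHyp U C₀ :=
    { contDiff := hU
      div_eq_zero := fun y => hdiv y
      norm_le := hUb
      abs_inner_le := fun y => by
        have h1 : |⟪U y, y⟫| ≤ ‖U y‖ * ‖y‖ := abs_real_inner_le_norm _ _
        have h2 : ‖U y‖ * ‖y‖ ≤ C₀ / (1 + ‖y‖) * ‖y‖ :=
          mul_le_mul_of_nonneg_right (hU0 y) (norm_nonneg y)
        have h3 : C₀ / (1 + ‖y‖) * ‖y‖ ≤ C₀ := by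
          rw [div_mul_eq_mul_div, div_le_iff₀ (by linarith [norm_nonneg y])]
          nlinarith [norm_nonneg y]
        linarith }
  -- the weight `w = γ v` of Prop. 5.1′
  obtain ⟨v, hv, hvpos, -, hv2, hG2, hker, hlow, hup⟩ :=
    hDH.exists_weight (ε := 3 / 4) (by norm_num) (by norm_num)
  have hw0 : ∀ y, 0 ≤ gaussWeight y * v y := fun y => (mul_pos (gaussWeight_pos y) (hvpos y)).le
  have hw_smooth : ContDiff ℝ ∞ (fun y => gaussWeight y * v y) := contDiff_gaussWeight.mul hv
  have hw2 : ContDiff ℝ 2 (fun y => gaussWeight y * v y) := hw_smooth.of_le (by norm_cast)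
  have hw_cont : Continuous (fun y => gaussWeight y * v y) := hw_smooth.continuous
  have hw_up : ∀ y, gaussWeight y * v y ≤ M * Real.exp (-(1 / 16 : ℝ) * ‖y‖ ^ 2) := fun y => by
    have h := hup y
    have e : Real.exp (-(1 - 3 / 4 : ℝ) * ‖y‖ ^ 2 / 4) = Real.exp (-(1 / 16 : ℝ) * ‖y‖ ^ 2) := by
      congr 1; ring
    rw [e] at h
    exact h
  have hw_low : ∀ y, m * Real.exp (-(7 / 16 : ℝ) * ‖y‖ ^ 2) ≤ gaussWeight y * v y := fun y => by
    have h := hlow y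
    have e : Real.exp (-(1 + 3 / 4 : ℝ) * ‖y‖ ^ 2 / 4) = Real.exp (-(7 / 16 : ℝ) * ‖y‖ ^ 2) := by
      congr 1; ring
    rw [e] at h
    exact h
  -- continuity of the players
  have hUc : Continuous U := hU.continuous
  have hDUc : Continuous fun y => fderiv ℝ U y := hU.continuous_fderiv (by simp)
  have hUd : Differentiable ℝ U := hU.differentiable (by simp)
  have hPd : Differentiable ℝ P := hP.differentiable (by simp)
  have hJc : Continuous (rotGen : EuclideanSpace ℝ (Fin 3) → EuclideanSpace ℝ (Fin 3)) :=
    rotGenL.continuous.congr fun v => rfl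
  have hRUc : Continuous fun y => rotGen (U y) - fderiv ℝ U y (rotGen y) :=
    (hJc.comp hUc).sub (hDUc.clm_apply hJc)
  have hdriftc : Continuous fun y : EuclideanSpace ℝ (Fin 3) => U y + (1 / 2 : ℝ) • y :=
    hUc.add (continuous_id.const_smul (1 / 2 : ℝ))
  have hHs : ContDiff ℝ ∞ (headPressure (1 / 2) U P) := contDiff_headPressure hU hP _
  have hHc : Continuous (headPressure (1 / 2) U P) := hHs.continuous
  have hsymmc : Continuous fun L : EuclideanSpace ℝ (Fin 3) →L[ℝ] ℝ =>
      (InnerProductSpace.toDual ℝ (EuclideanSpace ℝ (Fin 3))).symm L :=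
    (InnerProductSpace.toDual ℝ (EuclideanSpace ℝ (Fin 3))).symm.continuous
  have hgradHc : Continuous (gradient (headPressure (1 / 2) U P)) :=
    hsymmc.comp (hHs.continuous_fderiv (by simp))
  have hcurlc : Continuous (curl U) := by
    rw [curl_eq_curlCLM_comp]; exact curlCLM.continuous.comp hDUc
  have hEvc : Continuous fun y : EuclideanSpace ℝ (Fin 3) =>
      (1 / 2 : ℝ) * ⟪rotGen y, U y⟫ + ⟪U y + (1 / 2 : ℝ) • y, fderiv ℝ U y (rotGen y)⟫ :=
    (continuous_const.mul (hJc.inner hUc)).add (hdriftc.inner (hDUc.clm_apply hJc))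
  -- pointwise bounds (file `…RotationDefectBounds`)
  set Cp : ℝ := |α| * (C₀ + C₁) + C₀ + C₁ + C₂ + C₁ * C₀ with hCp
  have hCp0 : 0 ≤ Cp := by
    have hC₂0 : 0 ≤ C₂ := (norm_nonneg _).trans (hC₂ 0)
    positivity
  have hB4 : ∀ y, ‖fderiv ℝ P y‖ ≤ Cp * (1 + ‖y‖) := fun y => by
    have h := rotationDefect_norm_gradient_pressure_le hC₀.le hUb hC₁ hC₂ heq y
    have e : ‖gradient P y‖ = ‖fderiv ℝ P y‖ := by simp [gradient]
    rwa [e] at h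
  have hB5 : ∀ y, |P y| ≤ (|P 0| + Cp) * (1 + ‖y‖) ^ 2 :=
    rotationDefect_abs_pressure_le hPd hCp0 hB4
  have hB6 : ∀ y, |headPressure (1 / 2) U P y| ≤ (C₀ ^ 2 + (|P 0| + Cp) + C₀) * (1 + ‖y‖) ^ 2 :=
    rotationDefect_abs_head_le hC₀.le hUb hB5
  have hB7 : ∀ y, ‖gradient (headPressure (1 / 2) U P) y‖ ≤ (C₀ * C₁ + Cp + C₀ + C₁) * (1 + ‖y‖) :=
    rotationDefect_norm_gradient_head_le hUd hPd hC₀.le hUb hC₁ hCp0 hB4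
  -- the integrability hypotheses of (5.4)
  have iΩ : Integrable fun y => (gaussWeight y * v y) * ‖curl U y‖ ^ 2 :=
    rotationDefect_integrable_weight_mul (g := fun y => ‖curl U y‖ ^ 2) hw_cont
      ((continuous_norm.comp hcurlc).pow 2) hw0 hw_up
      (C := (‖curlCLM‖ * C₁) ^ 2) (N := 0) fun y => by
        rw [pow_zero, mul_one, abs_of_nonneg (sq_nonneg _)]
        exact rotationDefect_norm_curl_sq_le hC₁ y
  have iE : Integrable fun y => (gaussWeight y * v y) * ((1 / 2 : ℝ) * ⟪rotGen y, U y⟫ +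
      ⟪U y + (1 / 2 : ℝ) • y, fderiv ℝ U y (rotGen y)⟫) :=
    rotationDefect_integrable_weight_mul hw_cont hEvc hw0 hw_up (N := 2)
      (rotationDefect_abs_errorTerm_le_sq hC₀.le hUb hC₁)
  have h₁ : Integrable fun y => |gaussWeight y * v y| * ‖gradient (headPressure (1 / 2) U P) y‖ := by
    have h := rotationDefect_integrable_weight_mul
      (g := fun y => ‖gradient (headPressure (1 / 2) U P) y‖) hw_cont
      (continuous_norm.comp hgradHc) hw0 hw_up
      (N := 1) (C := C₀ * C₁ + Cp + C₀ + C₁) fun y => by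
        rw [abs_of_nonneg (norm_nonneg _), pow_one]; exact hB7 y
    refine h.congr (Eventually.of_forall fun y => ?_)
    simp only [abs_of_nonneg (hw0 y)]
  have h₂ : Integrable fun y => |headPressure (1 / 2) U P y| *
      ‖gradient (fun z => gaussWeight z * v z) y‖ :=
    rotationDefect_integrable_head_mul_gradient_weight hHc hB6 hv hvpos hv2 hG2
  have h₃ : Integrable fun y => |headPressure (1 / 2) U P y| * |gaussWeight y * v y| *
      ‖U y + (1 / 2 : ℝ) • y‖ := by
    have h := rotationDefect_integrable_weight_mul
      (g := fun y => |headPressure (1 / 2) U P y| * ‖U y + (1 / 2 : ℝ) • y‖) hw_cont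
      ((continuous_abs.comp hHc).mul (continuous_norm.comp hdriftc)) hw0 hw_up (N := 3)
      (C := (C₀ ^ 2 + (|P 0| + Cp) + C₀) * (C₀ + 1)) fun y => by
        rw [abs_mul, abs_abs, abs_of_nonneg (norm_nonneg _)]
        calc |headPressure (1 / 2) U P y| * ‖U y + (1 / 2 : ℝ) • y‖
            ≤ (C₀ ^ 2 + (|P 0| + Cp) + C₀) * (1 + ‖y‖) ^ 2 * ((C₀ + 1) * (1 + ‖y‖)) :=
              mul_le_mul (hB6 y) (rotationDefect_norm_drift_le hC₀.le hUb y) (norm_nonneg _)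
                ((abs_nonneg _).trans (hB6 y))
          _ = (C₀ ^ 2 + (|P 0| + Cp) + C₀) * (C₀ + 1) * (1 + ‖y‖) ^ 3 := by ring
    refine h.congr (Eventually.of_forall fun y => ?_)
    simp only [abs_of_nonneg (hw0 y)]; ring
  -- (5.4): `∫ w |Ω|² = α ∫ w E`
  have hΔP := fun y => twistedHead_sum_pderiv_pderiv_pressure (hU.of_le (by norm_cast))
    (hP.of_le (by norm_cast)) hdiv heq y
  have h54 := integral_weight_mul_norm_curl_sq hU hP hw2 heq hdiv hΔP hker iΩ iE h₁ h₂ h₃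
  -- right-hand side
  have iF : Integrable fun y => ‖U y + (1 / 2 : ℝ) • y‖ *
      ‖rotGen (U y) - fderiv ℝ U y (rotGen y)‖ * Real.exp (-‖y‖ ^ 2 / 16) := by
    refine rotationDefect_integrable_of_le_poly_gauss
      (((continuous_norm.comp hdriftc).mul (continuous_norm.comp hRUc)).mul
        (Real.continuous_exp.comp ((continuous_norm.pow 2).neg.div_const _))).aestronglyMeasurable
      (C := (C₀ + 1) * (C₀ + C₁)) (c := 1 / 16) (N := 2) (by norm_num) fun y => ?_
    have e : Real.exp (-‖y‖ ^ 2 / 16) = Real.exp (-(1 / 16 : ℝ) * ‖y‖ ^ 2) := by congr 1; ring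
    rw [Real.norm_eq_abs, abs_mul, abs_mul, abs_of_nonneg (norm_nonneg _),
      abs_of_nonneg (norm_nonneg _), abs_of_nonneg (Real.exp_pos _).le, e]
    have hprod : ‖U y + (1 / 2 : ℝ) • y‖ * ‖rotGen (U y) - fderiv ℝ U y (rotGen y)‖ ≤
        (C₀ + 1) * (C₀ + C₁) * (1 + ‖y‖) ^ 2 := by
      calc ‖U y + (1 / 2 : ℝ) • y‖ * ‖rotGen (U y) - fderiv ℝ U y (rotGen y)‖
          ≤ (C₀ + 1) * (1 + ‖y‖) * ((C₀ + C₁) * (1 + ‖y‖)) :=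
            mul_le_mul (rotationDefect_norm_drift_le hC₀.le hUb y)
              (rotationDefect_norm_defect_le hC₀.le hUb hC₁ y) (norm_nonneg _)
              (by nlinarith [hy1 y, hC₀.le])
        _ = (C₀ + 1) * (C₀ + C₁) * (1 + ‖y‖) ^ 2 := by ring
    calc ‖U y + (1 / 2 : ℝ) • y‖ * ‖rotGen (U y) - fderiv ℝ U y (rotGen y)‖ *
          Real.exp (-(1 / 16 : ℝ) * ‖y‖ ^ 2)
        ≤ (C₀ + 1) * (C₀ + C₁) * (1 + ‖y‖) ^ 2 * Real.exp (-(1 / 16 : ℝ) * ‖y‖ ^ 2) :=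
          mul_le_mul_of_nonneg_right hprod (Real.exp_pos _).le
      _ = (C₀ + 1) * (C₀ + C₁) * ((1 + ‖y‖) ^ 2 * Real.exp (-(1 / 16 : ℝ) * ‖y‖ ^ 2)) := by ring
  have hrhs := rotationDefect_weighted_enstrophy_le hw0 hw_up h54 iE iF
  -- left-hand side
  have hlhs : L * ∫ y in ball (0 : EuclideanSpace ℝ (Fin 3)) R, ‖curl U y‖ ^ 2 ≤
      ∫ y, (gaussWeight y * v y) * ‖curl U y‖ ^ 2 :=
    rotationDefect_mul_setIntegral_ball_le (R := R) hmpos.le hw_low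
      ((continuous_norm.comp hcurlc).pow 2) (fun y => sq_nonneg _) iΩ
  -- assemble
  have key := hlhs.trans hrhs
  rw [div_mul_eq_mul_div, le_div_iff₀ hLpos, mul_comm]
  exact key


/-! ### Registered form -/

/-- **Registered helper stub `rotationDefect_ballEnstrophyBound`** (explicit-binder form of
`rotationDefect_setIntegral_ball_norm_curl_sq_le`): the rotation-defect bound
`∫_{B_R} |curl U|² ≤ K(C₀, R) · |α| · ∫ ‖U + ½y‖ ‖RU‖ e^{−|y|²/16}` for smooth divergence-free
solutions of the RSS profile system with `|U| ≤ C₀/(1+|y|)` and bounded `DU`, `ΔU`.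
[cite: PineauVicol2026, (5.4) and proof of Thm. 1.4 small |α| (p. 13); Prop. 5.1 (p. 12)] -/
theorem rotationDefect_ballEnstrophyBound :
    ∀ (C₀ : ℝ), 0 < C₀ → ∀ (R : ℝ), ∃ K : ℝ, 0 < K ∧ ∀ (α : ℝ) (U : EuclideanSpace ℝ (Fin 3) → EuclideanSpace ℝ (Fin 3)) (P : EuclideanSpace ℝ (Fin 3) → ℝ), ContDiff ℝ (⊤ : ℕ∞) U → ContDiff ℝ (⊤ : ℕ∞) P → Literature.Analysis.FluidPDE.VectorCalculus.IsDivFree U → (∀ y : EuclideanSpace ℝ (Fin 3), α • (Literature.Analysis.FluidPDE.rotGen (U y) - fderiv ℝ U y (Literature.Analysis.FluidPDE.rotGen y)) + (1 / 2 : ℝ) • U y + (1 / 2 : ℝ) • fderiv ℝ U y y - Laplacian.laplacian U y + fderiv ℝ U y (U y) + gradient P y = 0) → (∀ y : EuclideanSpace ℝ (Fin 3), ‖U y‖ ≤ C₀ / (1 + ‖y‖)) → (∃ C₁ : ℝ, ∀ y : EuclideanSpace ℝ (Fin 3), ‖fderiv ℝ U y‖ ≤ C₁) → (∃ C₂ :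 ℝ, ∀ y : EuclideanSpace ℝ (Fin 3), ‖Laplacian.laplacian U y‖ ≤ C₂) → ∫ y in Metric.ball (0 : EuclideanSpace ℝ (Fin 3)) R, ‖Literature.Analysis.FluidPDE.curl U y‖ ^ 2 ≤ K * (|α| * ∫ y : EuclideanSpace ℝ (Fin 3), ‖U y + (1 / 2 : ℝ) • y‖ * ‖Literature.Analysis.FluidPDE.rotGen (U y) - fderiv ℝ U y (Literature.Analysis.FluidPDE.rotGen y)‖ * Real.exp (-‖y‖ ^ 2 / 16)) :=
  fun _ hC₀ R => rotationDefect_setIntegral_ball_norm_curl_sq_le hC₀ R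

end Summit.NavierStokesRegularity.NavierStokesRegularity.Theorems

end
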